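import Literature.Probability.RandomPlanarGeometry.SLEThroughSwallowMartingale
import HarnessLib

/-!
# The through-swallow clock of SLE₆ under the STRICT cluster dichotomy (every path)

Sequel of `SLEThroughSwallowMartingale` (Lawler–Schramm–Werner (2001) Thm. 2.2 / G. F. Lawler (2005) §6.3
Thm. 6.13). The horizon `thrHorizon` of `SLEThrHorizon` guarantees the cluster dichotomy ("every cluster is
inside the closed hull or disjoint from it") at all times STRICTLY before the horizon on every path, and up
to and including the horizon only almost surely. The CLOCK side of the gluing needs only the strict form:
theorems only, every path.

* `integrableOn_thrClockRate_of_clusterwise_lt` — the through-swallow clock rate is integrable on `[0, h]`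
  when the dichotomy holds at all `t < h` (`[0, h) = ⋃ₙ [0, βₙ]`, the rate is bounded by `1`);
  `thrClock_min_mono_of_lt` — the clock process `σ_A(t ∧ H)` is nondecreasing and `1`-Lipschitz;
* `tendsto_pieceClock_of_hullHitTime_eq`, `tendsto_pieceClock_of_mem_piece` — the level-`n` piece clocks
  converge on the closed piece (no closedness of the remaining hull is needed for the clocks);
* `thrClock_sub_eq_imageClock_sub_of_lt`, `tendsto_pieceClockIncr_of_lt`, `tendsto_sum_pieceClockIncr_of_lt`,
  `adapted_thrClock_min_of_lt` — the clock increments over the pieces, the convergence of the level-`n` clock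
  sums to `σ_A(t ∧ H)` on every path, and the adaptedness of the clock process.

## References

* G. F. Lawler, O. Schramm, W. Werner, Acta Math. **187** (2001), Thm. 2.2. [LawlerSchrammWerner2001]
* G. F. Lawler (2005), §6.3 Thm. 6.13, Prop. 4.41. [Lawler2005]
-/

noncomputable section

open Set Filter Metric Function MeasureTheory
open _root_.Complex _root_.Topology
open scoped NNReal

namespace Literature.Probability.RandomPlanarGeometry

open Loewner Literature.Probability.Process

variable {κ : ℝ≥0} {A : Set ℂ} {hA : IsStarHull A} {δ : ℝ} {hδ : 0 < δ} {H : (ℝ≥0 → ℝ) → WithTop ℝ≥0}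

/-! ### The clock under the STRICT dichotomy (every path) -/

section StrictClock

variable {s : Finset (Set ℂ)} {ω : ℝ≥0 → ℝ}

/-- **The through-swallow clock rate is integrable up to `h` when the cluster dichotomy holds at all
times `t < h`** (closedness and finiteness of the remaining hulls on every `[0, β]`, `β < h`; the rate is
bounded by `1`). [folklore] -/
theorem integrableOn_thrClockRate_of_clusterwise_lt (hA : IsStarHull A) (hδ : 0 < δ) {ω : ℝ≥0 → ℝ} {h : ℝ≥0}
    (hclw : ∀ t : ℝ≥0, t < h → ∀ a ∈ A, deltaCluster A δ a ⊆ closedHull (drvK κ (brownianCPath ω)) t ∨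
      Disjoint (deltaCluster A δ a) (closedHull (drvK κ (brownianCPath ω)) t)) :
    IntegrableOn (thrClockRate (drvK κ (brownianCPath ω)) A) (Icc (0 : ℝ) h) := by
  set W := drvK κ (brownianCPath ω) with hWdef
  have hβ : ∀ β : ℝ≥0, β < h → IntegrableOn (thrClockRate W A) (Icc (0 : ℝ) β) := fun β hβ ↦
    integrableOn_thrClockRate_of_clusterwise (κ := κ) hA hδ fun t ht ↦ hclw t (lt_of_le_of_lt ht hβ)
  -- `[0, h) = ⋃ₙ [0, h n/(n+1)]`
  set β : ℕ → ℝ≥0 := fun n ↦ h * ((n : ℝ≥0) / ((n : ℝ≥0) + 1)) with hβdef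
  have hβlt : ∀ n, 0 < h → β n < h := fun n hh ↦ by
    have : ((n : ℝ≥0) / ((n : ℝ≥0) + 1)) < 1 := by
      rw [div_lt_one (by positivity)]; exact lt_add_one _
    calc β n = h * ((n : ℝ≥0) / ((n : ℝ≥0) + 1)) := rfl
      _ < h * 1 := by gcongr
      _ = h := mul_one h
  have hcover : Ico (0 : ℝ) h ⊆ ⋃ n : ℕ, Icc (0 : ℝ) (β n) := by
    intro r hr
    have hh : (0 : ℝ) < h := hr.1.trans_lt hr.2
    -- choose `n` with `r ≤ h n/(n+1)`, i.e. `r ≤ h - h/(n+1)`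
    obtain ⟨n, hn⟩ := exists_nat_gt ((h : ℝ) / ((h : ℝ) - r))
    refine mem_iUnion.2 ⟨n, hr.1, ?_⟩
    have hgap : 0 < (h : ℝ) - r := sub_pos.2 hr.2
    have hn' : (h : ℝ) < ((n : ℝ) + 1) * ((h : ℝ) - r) := by
      have := (div_lt_iff₀ hgap).1 hn; nlinarith
    have hcoe : ((β n : ℝ≥0) : ℝ) = (h : ℝ) * (n : ℝ) / ((n : ℝ) + 1) := by
      simp only [hβdef]; push_cast; ring
    rw [hcoe, le_div_iff₀ (by positivity : (0 : ℝ) < (n : ℝ) + 1)]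
    nlinarith
  have hmeas : AEStronglyMeasurable (thrClockRate W A) (volume.restrict (Ico (0 : ℝ) h)) := by
    have h1 : AEStronglyMeasurable (thrClockRate W A) (volume.restrict (⋃ n : ℕ, Icc (0 : ℝ) (β n))) := by
      rw [aestronglyMeasurable_iUnion_iff]
      intro n
      rcases eq_zero_or_pos (a := h) with hh | hh
      · have : Icc (0 : ℝ) (β n) = {0} := by
          rw [show β n = 0 by simp [hβdef, hh], NNReal.coe_zero, Icc_self]
        rw [this, Measure.restrict_singleton]
        simp only [Real.volume_singleton, zero_smul]
        exact aestronglyMeasurable_zero_measure _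
      · exact (hβ (β n) (hβlt n hh)).aestronglyMeasurable
    exact h1.mono_measure (Measure.restrict_mono hcover le_rfl)
  have hIco : IntegrableOn (thrClockRate W A) (Ico (0 : ℝ) h) := by
    refine Integrable.mono' (integrableOn_const (measure_Ico_lt_top (a := (0 : ℝ)) (b := (h : ℝ))).ne (C := (1 : ℝ))) hmeas ?_
    filter_upwards with r
    rw [Real.norm_eq_abs, abs_of_pos (thrClockRate_pos_le_one W A r).1]
    exact (thrClockRate_pos_le_one W A r).2
  rw [integrableOn_Icc_iff_integrableOn_Ico]
  exact hIco

/-- **The clock process `c t = σ_A(t ∧ H)` is nondecreasing and `1`-Lipschitz on EVERY path** under the strict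
dichotomy. [folklore] -/
theorem thrClock_min_mono_of_lt (hA : IsStarHull A) (hδ : 0 < δ) {ω : ℝ≥0 → ℝ} (hH : H ω ≠ ⊤)
    (hclw : ∀ t : ℝ≥0, (t : WithTop ℝ≥0) < H ω → ∀ a ∈ A, deltaCluster A δ a ⊆ closedHull (drvK κ (brownianCPath ω)) t ∨
      Disjoint (deltaCluster A δ a) (closedHull (drvK κ (brownianCPath ω)) t)) {s t : ℝ≥0} (hst : s ≤ t) :
    thrClock (drvK κ (brownianCPath ω)) A (min (s : ℝ) (((H ω).untopD 0 : ℝ≥0) : ℝ)) ≤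
        thrClock (drvK κ (brownianCPath ω)) A (min (t : ℝ) (((H ω).untopD 0 : ℝ≥0) : ℝ)) ∧
      thrClock (drvK κ (brownianCPath ω)) A (min (t : ℝ) (((H ω).untopD 0 : ℝ≥0) : ℝ)) -
          thrClock (drvK κ (brownianCPath ω)) A (min (s : ℝ) (((H ω).untopD 0 : ℝ≥0) : ℝ)) ≤ (t : ℝ) - s := by
  obtain ⟨h, hh⟩ := WithTop.ne_top_iff_exists.1 hH
  have hint := integrableOn_thrClockRate_of_clusterwise_lt (κ := κ) hA hδ (ω := ω) (h := h)
    fun u hu ↦ hclw u (by rw [← hh]; exact WithTop.coe_lt_coe.2 hu)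
  simp only [← hh, WithTop.untopD_coe]
  rcases (min_le_min_right (h : ℝ) (NNReal.coe_le_coe.2 hst)).eq_or_lt with heq | hlt
  · rw [heq]; exact ⟨le_rfl, by rw [sub_self]; exact sub_nonneg.2 (NNReal.coe_le_coe.2 hst)⟩
  · have := thrClock_sub_mem hint (le_min s.coe_nonneg h.coe_nonneg) hlt (min_le_right _ _)
    exact ⟨by linarith [this.1], by linarith [this.2, min_sub_min_le_sub (NNReal.coe_le_coe.2 hst) (σ := (h : ℝ))]⟩

/-- **Limit of the piece CLOCK at the contact time of the piece hull** (no closedness needed):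
`pieceClock^{s,n}_u → imageClock W B_s u` when `T_{B_s} = u`. [folklore] -/
theorem tendsto_pieceClock_of_hullHitTime_eq (hs : s ⊆ clusterFinset hA hδ) (hne : s ≠ clusterFinset hA hδ)
    {u : ℝ≥0} (hT : hullHitTime (drvK κ (brownianCPath ω)) (pieceHull A s) = u) :
    Tendsto (fun n ↦ pieceClock κ hA hδ s n u ω) atTop (𝓝 (imageClock (drvK κ (brownianCPath ω)) (pieceHull A s) u)) := by
  set W := drvK κ (brownianCPath ω) with hWdef
  set B := pieceHull A s with hBdef
  have hB : IsStarHull B := isStarHull_pieceHull hA hδ hs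
  have hBne : B.Nonempty := pieceHull_nonempty hA hδ hs hne
  have hWc : Continuous W := continuous_drvK κ _
  have hint := intervalIntegrable_imageClockRate_of_le_hullHitTime hWc hB (u := u) (by rw [hT])
  simp only [pieceClock_of_ne hs hne]
  set loc : ℕ → WithTop ℝ≥0 := fun n ↦ imgLocTimeK κ hB hBne n ω with hloc
  set v : ℕ → ℝ≥0 := fun n ↦ (loc n).untopA with hv
  have hvcoe : ∀ n, (v n : WithTop ℝ≥0) = loc n := fun n ↦ by
    have hx : loc n ≠ ⊤ := imgLocTimeK_ne_top n ω
    show (((loc n).untopA : ℝ≥0) : WithTop ℝ≥0) = loc n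
    rw [WithTop.untopA_eq_untop hx, WithTop.coe_untop]
  have hdead : ¬ Disjoint (closedHull W u) B := fun h ↦ by
    have := (disjoint_closedHull_iff_lt_hullHitTime hWc hB hBne).1 h
    rw [hT] at this
    exact lt_irrefl _ this
  have halive : ∀ u' < u, Disjoint (closedHull W u') B := fun u' hu' ↦
    disjoint_closedHull_of_lt_hullHitTime (by rw [hT]; exact_mod_cast hu')
  have hlocle : ∀ n, loc n ≤ u := by
    intro n
    have hR : RpK κ hB hBne u ω = 0 := by
      have h1 := RFnK_nonneg (κ := κ) (hA := hB) (hne := hBne) u (brownianCPath ω)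
      have h2 : ¬ 0 < RFnK κ hB hBne u (brownianCPath ω) := fun h ↦ hdead ((RFnK_pos_iff u _).1 h)
      exact le_antisymm (not_lt.1 h2) h1
    have hmem : RpK κ hB hBne u ω ∈ Iic (locLevel n) := by rw [hR]; exact (locLevel_pos_le n).1.le
    calc loc n ≤ locTimeK κ hB hBne n ω := imgLocTimeK_le_locTimeK n ω
      _ ≤ hittingAfter (RpK κ hB hBne) (Iic (locLevel n)) 0 ω := (min_le_left _ _).trans (min_le_left _ _)
      _ ≤ u := hittingAfter_le_of_mem bot_le hmem
  have hvle : ∀ n, v n ≤ u := fun n ↦ by have := hlocle n; rw [← hvcoe] at this; exact WithTop.coe_le_coe.1 this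
  have h0 : ∀ᶠ n in atTop, (0 : WithTop ℝ≥0) < loc n :=
    eventually_lt_imgLocTimeK (κ := κ) hB hBne (ω := ω) (t := 0) (disjoint_closedHull_zeroK hB _)
  have hvtend : Tendsto v atTop (𝓝 u) := by
    refine tendsto_order.2 ⟨fun u' hu' ↦ ?_, fun u' hu' ↦ Eventually.of_forall fun n ↦ (hvle n).trans_lt hu'⟩
    filter_upwards [eventually_lt_imgLocTimeK (κ := κ) hB hBne (halive u' hu')] with n hn
    have hn' : ((u' : ℝ≥0) : WithTop ℝ≥0) < v n := by rw [hvcoe]; exact hn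
    exact_mod_cast hn'
  have hev : ∀ᶠ n in atTop, imgClockK κ hB hBne n u ω = imageClock W B (v n) := by
    filter_upwards [h0] with n hn
    have h1 : imgClockK κ hB hBne n u ω = imgClockK κ hB hBne n (v n) ω := by
      rw [imgClockK_eq_timeIntegral_min, imgClockK_eq_timeIntegral_min, min_eq_right (hlocle n), min_eq_left (hvcoe n).le]
      rfl
    rw [h1, imgClockK_eq_imageClock (by rw [hvcoe]) hn]
  refine Tendsto.congr' (EventuallyEq.symm hev) ?_
  have hint' : IntegrableOn (imageClockRate W B) (uIcc (0 : ℝ) u) volume := by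
    rw [uIcc_of_le u.coe_nonneg]; exact (intervalIntegrable_iff_integrableOn_Icc_of_le u.coe_nonneg).1 hint
  have hcont : ContinuousOn (imageClock W B) (uIcc (0 : ℝ) u) := by
    have h := intervalIntegral.continuousOn_primitive_interval (μ := volume) hint'
    have heq : (fun x ↦ ∫ t in (0 : ℝ)..x, imageClockRate W B t) = imageClock W B := by funext x; rw [imageClock]
    rwa [heq] at h
  have hu0 : (u : ℝ) ∈ uIcc (0 : ℝ) u := by rw [uIcc_of_le u.coe_nonneg]; exact ⟨u.coe_nonneg, le_rfl⟩
  have h2 : Tendsto (fun n ↦ ((v n : ℝ≥0) : ℝ)) atTop (𝓝[uIcc (0 : ℝ) u] u) := by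
    refine tendsto_nhdsWithin_iff.2 ⟨NNReal.continuous_coe.continuousAt.tendsto.comp hvtend, Eventually.of_forall fun n ↦ ?_⟩
    rw [uIcc_of_le u.coe_nonneg]; exact ⟨(v n).coe_nonneg, by exact_mod_cast hvle n⟩
  exact (hcont u hu0).tendsto.comp h2

/-- **Limit of the piece clock on the closed piece `[ρ_s, σ_s]`** (nonempty piece; no dichotomy needed):
`pieceClock^{s,n}_u → imageClock W B_s u`. [folklore] -/
theorem tendsto_pieceClock_of_mem_piece (hs : s ⊆ clusterFinset hA hδ)
    (hlt : thrRho κ hA hδ H s ω < thrSigma κ hA hδ H s ω) {u : ℝ≥0} (hρu : thrRho κ hA hδ H s ω ≤ u)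
    (huσ : (u : WithTop ℝ≥0) ≤ thrSigma κ hA hδ H s ω) :
    Tendsto (fun n ↦ pieceClock κ hA hδ s n u ω) atTop (𝓝 (imageClock (drvK κ (brownianCPath ω)) (pieceHull A s) u)) := by
  obtain ⟨hab, -, -⟩ := pieceStart_lt_of_thrRho_lt hlt
  set W := drvK κ (brownianCPath ω) with hWdef
  have hWc : Continuous W := continuous_drvK κ _
  set b := pieceEnd W (clusterFinset hA hδ) s with hbdef
  have hub : (u : WithTop ℝ≥0) ≤ b := huσ.trans (min_le_left _ _)
  have hbT : b = hullHitTime W (pieceHull A s) := pieceEnd_eq_hullHitTime hWc hA hδ hs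
  rcases hub.lt_or_eq with hlt' | heq'
  · have halive : Disjoint (closedHull W u) (pieceHull A s) := disjoint_closedHull_of_lt_hullHitTime (hbT ▸ hlt')
    exact tendsto_const_nhds.congr' ((eventually_pieceMart_eq (κ := κ) hs halive).mono fun n hn ↦ hn.2.symm)
  · have hne : s ≠ clusterFinset hA hδ := by
      rintro rfl
      have : b = ⊤ := by rw [hbdef, pieceEnd, Finset.sdiff_self, Finset.inf_empty]
      rw [this] at heq'; exact WithTop.coe_ne_top heq'
    exact tendsto_pieceClock_of_hullHitTime_eq hs hne (by rw [← hbT, heq'])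

/-- **The clock increment over a piece is the capacity-clock increment of the piece hull**, under the STRICT
dichotomy (interior times of the piece only). [folklore] -/
theorem thrClock_sub_eq_imageClock_sub_of_lt (hs : s ⊆ clusterFinset hA hδ) (hH : H ω ≠ ⊤)
    (hclw : ∀ t : ℝ≥0, (t : WithTop ℝ≥0) < H ω → ∀ a ∈ A, deltaCluster A δ a ⊆ closedHull (drvK κ (brownianCPath ω)) t ∨
      Disjoint (deltaCluster A δ a) (closedHull (drvK κ (brownianCPath ω)) t))
    (hlt : thrRho κ hA hδ H s ω < thrSigma κ hA hδ H s ω) {ρ' u : ℝ≥0} (hρρ : thrRho κ hA hδ H s ω ≤ ρ') (hρu : ρ' ≤ u)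
    (huσ : (u : WithTop ℝ≥0) ≤ thrSigma κ hA hδ H s ω) :
    thrClock (drvK κ (brownianCPath ω)) A u - thrClock (drvK κ (brownianCPath ω)) A ρ' =
      imageClock (drvK κ (brownianCPath ω)) (pieceHull A s) u - imageClock (drvK κ (brownianCPath ω)) (pieceHull A s) ρ' := by
  obtain ⟨hab, hah, hρa⟩ := pieceStart_lt_of_thrRho_lt hlt
  set W := drvK κ (brownianCPath ω) with hWdef
  have hWc : Continuous W := continuous_drvK κ _
  set B := pieceHull A s with hBdef
  obtain ⟨h, hh⟩ := WithTop.ne_top_iff_exists.1 hH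
  have huh : (u : WithTop ℝ≥0) ≤ H ω := huσ.trans (min_le_right _ _)
  have huh' : u ≤ h := by rw [← hh] at huh; exact WithTop.coe_le_coe.1 huh
  have hub : (u : WithTop ℝ≥0) ≤ hullHitTime W B := (huσ.trans (min_le_left _ _)).trans_eq (pieceEnd_eq_hullHitTime hWc hA hδ hs)
  have haρ : pieceStart W s ≤ ρ' := hρa ▸ hρρ
  have hintA := integrableOn_thrClockRate_of_clusterwise_lt (κ := κ) hA hδ (ω := ω) (h := h)
    fun t ht ↦ hclw t (by rw [← hh]; exact WithTop.coe_lt_coe.2 ht)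
  have h0I : (0 : ℝ) ∈ Icc (0 : ℝ) h := ⟨le_rfl, h.coe_nonneg⟩
  have huI : (u : ℝ) ∈ Icc (0 : ℝ) h := ⟨u.coe_nonneg, by exact_mod_cast huh'⟩
  have hρI : (ρ' : ℝ) ∈ Icc (0 : ℝ) h := ⟨ρ'.coe_nonneg, by exact_mod_cast hρu.trans huh'⟩
  have hiA := fun {x y : ℝ} (hx : x ∈ Icc (0 : ℝ) h) (hy : y ∈ Icc (0 : ℝ) h) ↦ intervalIntegrable_thrClockRate hintA hx hy
  have hiBu := intervalIntegrable_imageClockRate_of_le_hullHitTime hWc (isStarHull_pieceHull hA hδ hs) hub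
  have hiBρ := intervalIntegrable_imageClockRate_of_le_hullHitTime hWc (isStarHull_pieceHull hA hδ hs)
    ((WithTop.coe_le_coe.2 hρu).trans hub)
  rw [thrClock, thrClock, imageClock, imageClock, intervalIntegral.integral_interval_sub_left (hiA h0I huI) (hiA h0I hρI),
    intervalIntegral.integral_interval_sub_left hiBu hiBρ]
  refine intervalIntegral.integral_congr_ae ?_
  rw [MeasureTheory.ae_iff]
  refine measure_mono_null (fun r hr ↦ ?_) (measure_singleton (u : ℝ))
  simp only [mem_setOf_eq, Classical.not_imp] at hr
  obtain ⟨hrI, hne⟩ := hr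
  rw [uIoc_of_le (by exact_mod_cast hρu : (ρ' : ℝ) ≤ u)] at hrI
  by_contra hru
  refine hne ?_
  have hr0 : 0 ≤ r := ρ'.coe_nonneg.trans hrI.1.le
  have hrlt : (r : ℝ) < u := lt_of_le_of_ne hrI.2 hru
  have h1 : pieceStart W s ≤ r.toNNReal :=
    haρ.trans (WithTop.coe_le_coe.2 (by rw [← NNReal.coe_le_coe, Real.coe_toNNReal _ hr0]; exact hrI.1.le))
  have h2 : ((r.toNNReal : ℝ≥0) : WithTop ℝ≥0) < (u : WithTop ℝ≥0) := by
    have : r.toNNReal < u := by rw [← NNReal.coe_lt_coe, Real.coe_toNNReal _ hr0]; exact hrlt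
    exact_mod_cast this
  have hrem : remHull W A r.toNNReal = B := by
    rw [remHull_eq_pieceHull_swallowedAt hWc hA hδ (hclw _ (h2.trans_le huh)),
      (pieceStart_le_and_lt_pieceEnd_iff hs).1 ⟨h1, h2.trans_le (huσ.trans (min_le_left _ _))⟩]
  rw [thrClockRate_eq_imageClockRate_remHull (rfl : remHull W A r.toNNReal = remHull W A r.toNNReal), hrem]

/-- **The piece clock increment converges**, under the strict dichotomy: `ΔC^{s,n}_t → σ_A(t ∧ σ_s) − σ_A(t ∧ ρ_s)`.
[folklore] -/
theorem tendsto_pieceClockIncr_of_lt (hs : s ⊆ clusterFinset hA hδ) (hH : H ω ≠ ⊤)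
    (hclw : ∀ t : ℝ≥0, (t : WithTop ℝ≥0) < H ω → ∀ a ∈ A, deltaCluster A δ a ⊆ closedHull (drvK κ (brownianCPath ω)) t ∨
      Disjoint (deltaCluster A δ a) (closedHull (drvK κ (brownianCPath ω)) t)) (t : ℝ≥0) :
    Tendsto (fun n ↦ pieceClockIncr κ hA hδ H s n t ω) atTop
      (𝓝 (thrClock (drvK κ (brownianCPath ω)) A ((min (t : WithTop ℝ≥0) (thrSigma κ hA hδ H s ω)).untopA : ℝ≥0) -
        thrClock (drvK κ (brownianCPath ω)) A ((min (t : WithTop ℝ≥0) (thrRho κ hA hδ H s ω)).untopA : ℝ≥0))) := by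
  rcases (thrRho_le_thrSigma (κ := κ) (hA := hA) (hδ := hδ) (H := H) s ω).eq_or_lt with heq | hlt
  · have h1 : ∀ n, pieceClockIncr κ hA hδ H s n t ω = 0 := fun n ↦ by simp only [pieceClockIncr, stoppedProcess, heq, sub_self]
    simp only [h1, heq, sub_self]; exact tendsto_const_nhds
  rcases le_or_gt (t : WithTop ℝ≥0) (thrRho κ hA hδ H s ω) with htρ | hρt
  · have htσ : (t : WithTop ℝ≥0) ≤ thrSigma κ hA hδ H s ω := htρ.trans hlt.le
    have h1 : ∀ n, pieceClockIncr κ hA hδ H s n t ω = 0 := fun n ↦ by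
      simp only [pieceClockIncr, stoppedProcess_eq_of_le htρ, stoppedProcess_eq_of_le htσ, sub_self]
    simp only [h1, min_eq_left htρ, min_eq_left htσ, sub_self]; exact tendsto_const_nhds
  · obtain ⟨ρ', hρ'⟩ := WithTop.ne_top_iff_exists.1 hρt.ne_top
    set u : ℝ≥0 := (min (t : WithTop ℝ≥0) (thrSigma κ hA hδ H s ω)).untopA with hudef
    have hucoe : (u : WithTop ℝ≥0) = min (t : WithTop ℝ≥0) (thrSigma κ hA hδ H s ω) :=
      Literature.Analysis.FunctionSpaces.coe_untopA_min _ _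
    have hρu' : ((ρ' : ℝ≥0) : WithTop ℝ≥0) ≤ u := by rw [hucoe, hρ']; exact le_min hρt.le hlt.le
    have hρu : ρ' ≤ u := WithTop.coe_le_coe.1 hρu'
    have huσ : (u : WithTop ℝ≥0) ≤ thrSigma κ hA hδ H s ω := by rw [hucoe]; exact min_le_right _ _
    have hρρ : thrRho κ hA hδ H s ω ≤ ρ' := by rw [hρ']
    have hρσ : ((ρ' : ℝ≥0) : WithTop ℝ≥0) ≤ thrSigma κ hA hδ H s ω := by rw [hρ']; exact hlt.le
    have h1 := tendsto_pieceClock_of_mem_piece (κ := κ) hs hlt (hρρ.trans hρu') huσ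
    have h2 := tendsto_pieceClock_of_mem_piece (κ := κ) hs hlt hρρ hρσ
    have hmin : (min (t : WithTop ℝ≥0) (thrRho κ hA hδ H s ω)).untopA = ρ' := by rw [min_eq_right hρt.le, ← hρ']; rfl
    have heq : ∀ n, pieceClockIncr κ hA hδ H s n t ω = pieceClock κ hA hδ s n u ω - pieceClock κ hA hδ s n ρ' ω := fun n ↦ by
      simp only [pieceClockIncr, stoppedProcess, hmin, hudef]
    have htarget : thrClock (drvK κ (brownianCPath ω)) A ((min (t : WithTop ℝ≥0) (thrSigma κ hA hδ H s ω)).untopA : ℝ≥0) -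
        thrClock (drvK κ (brownianCPath ω)) A ((min (t : WithTop ℝ≥0) (thrRho κ hA hδ H s ω)).untopA : ℝ≥0) =
        thrClock (drvK κ (brownianCPath ω)) A u - thrClock (drvK κ (brownianCPath ω)) A ρ' := by
      simp only [hmin, hudef]
    rw [htarget, thrClock_sub_eq_imageClock_sub_of_lt hs hH hclw hlt hρρ hρu huσ]
    exact (h1.sub h2).congr fun n ↦ (heq n).symm

/-- **The level-`n` clock sums converge to `σ_A(t ∧ H)` on EVERY path** under the strict dichotomy. [folklore] -/
theorem tendsto_sum_pieceClockIncr_of_lt (hA : IsStarHull A) (hδ : 0 < δ) (hH : H ω ≠ ⊤)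
    (hclw : ∀ t : ℝ≥0, (t : WithTop ℝ≥0) < H ω → ∀ a ∈ A, deltaCluster A δ a ⊆ closedHull (drvK κ (brownianCPath ω)) t ∨
      Disjoint (deltaCluster A δ a) (closedHull (drvK κ (brownianCPath ω)) t)) (t : ℝ≥0) :
    Tendsto (fun n ↦ ∑ s ∈ (clusterFinset hA hδ).powerset, pieceClockIncr κ hA hδ H s n t ω) atTop
      (𝓝 (thrClock (drvK κ (brownianCPath ω)) A ((min (t : WithTop ℝ≥0) (H ω)).untopA : ℝ≥0))) := by
  rw [thrClock_eq_sum (κ := κ) (H := H) hA hδ t ω]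
  exact tendsto_finsetSum _ fun s hs ↦ tendsto_pieceClockIncr_of_lt (Finset.mem_powerset.1 hs) hH hclw t

/-- **The clock process is adapted on every path, under the strict dichotomy.** [folklore] -/
theorem adapted_thrClock_min_of_lt (hA : IsStarHull A) (hδ : 0 < δ) (hH : IsStoppingTime brownianFiltration H)
    (hHt : ∀ ω, H ω ≠ ⊤)
    (hclw : ∀ (ω : ℝ≥0 → ℝ) (t : ℝ≥0), (t : WithTop ℝ≥0) < H ω → ∀ a ∈ A,
      deltaCluster A δ a ⊆ closedHull (drvK κ (brownianCPath ω)) t ∨ Disjoint (deltaCluster A δ a) (closedHull (drvK κ (brownianCPath ω)) t)) :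
    Adapted brownianFiltration fun t ω ↦ thrClock (drvK κ (brownianCPath ω)) A (min (t : ℝ) (((H ω).untopD 0 : ℝ≥0) : ℝ)) := by
  intro t
  have hf : ∀ n, StronglyMeasurable[brownianFiltration t] fun ω ↦ ∑ s ∈ (clusterFinset hA hδ).powerset, pieceClockIncr κ hA hδ H s n t ω :=
    fun n ↦ by
    refine Finset.stronglyMeasurable_fun_sum _ fun s hs ↦ ?_
    have hs' := Finset.mem_powerset.1 hs
    obtain ⟨had, hc, -⟩ := pieceClock_spec (κ := κ) hs' n
    have hprog : IsStronglyProgressive brownianFiltration (pieceClock κ hA hδ s n) :=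
      had.stronglyAdapted.isStronglyProgressive_of_continuous hc
    exact ((hprog.stronglyAdapted_stoppedProcess (isStoppingTime_thrSigma hH s)) t).sub
      ((hprog.stronglyAdapted_stoppedProcess (isStoppingTime_thrRho hH hs')) t)
  have hlim := stronglyMeasurable_of_tendsto atTop hf (tendsto_pi_nhds.2 fun ω ↦ tendsto_sum_pieceClockIncr_of_lt hA hδ (hHt ω) (hclw ω) t)
  have heq : (fun ω ↦ thrClock (drvK κ (brownianCPath ω)) A (min (t : ℝ) (((H ω).untopD 0 : ℝ≥0) : ℝ))) =
      fun ω ↦ thrClock (drvK κ (brownianCPath ω)) A ((min (t : WithTop ℝ≥0) (H ω)).untopA : ℝ≥0) := by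
    funext ω; rw [min_untopD_eq (hHt ω)]
  show Measurable[brownianFiltration t] fun ω ↦ thrClock (drvK κ (brownianCPath ω)) A (min (t : ℝ) (((H ω).untopD 0 : ℝ≥0) : ℝ))
  rw [heq]
  exact hlim.measurable

end StrictClock


end Literature.Probability.RandomPlanarGeometry

end
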